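import Mathlib
import Summits.ResolutionOfSingularities.ResolutionOfSingularities.Theorems.WeightedConstruction.Negative.K1WildOrbitFace
import HarnessLib

/-!
# K1 certificate, piece (C2): at the orbit-generic successor of `x² + y⁷ + yz⁴ / 𝔽₂` NO two-flag reaches a ratio `> 2`
# — the coefficient contradiction in the completed model `K⟦T, X, Z⟧` (char 2, the `Z⁴`-coefficient a non-square)

Route `ResolutionOfSingularities/WeightedInvariant`, door crux `HypersurfaceCentreConstruction` (stmt-ResolutionOfSingularities-19897), P3 rung;
ORDER (o50) (K-wild-hom) of res-L1-w43-plan-1, kernel item «K1 certificate» (memo `plan/tools/res-type-060/o50/K-WILD-HOM.md` §4, design of record),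
piece (C2); res-type-060 (gen 10).  Piece (C1) = `…Iota3FlagRatioTwoBound` (an order-2 germ reaching a triple of ratio `> 2` along a two-flag
`(g₁, g₂)` is `a·g₁² + g₁·b + c` with `b ∈ 𝔪³`, `c ∈ 𝔪⁵`).  [OURS · L1 W4.3 · helper, counted 0] — coefficient algebra in `MvPowerSeries (Fin 3) K`
over res-L1-w43-tri-1's char-2 square lemma `K1WildOrbitFace.coeff_add_self_sq` (p538148); nothing here is a statement of the manuscript under review
(Hironaka 2017).  AI proof, weaker than expert review.

THE STATEMENT (`not_eq_sq_flag_form`).  `K` a field of characteristic `2`, `y ∈ K` NOT a square, `y' ∈ K` arbitrary; in `K⟦T, X, Z⟧` (indices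
`0 = T, 1 = X, 2 = Z`) let `g = X² + y·Z⁴ + y'·T⁴ + P` with `ord P ≥ 5` (the completed orbit-generic successor `X² + YZ⁴ + Y⁷T⁴` of K1 has this
shape after writing the units `Y, Y⁷` as constants plus higher terms; `y = ` the residue of `Y` in `κ(η) = 𝔽₂(Y)`, a non-square).  Then `g` is NOT
of the form `a·g₁² + g₁·b + c` with `g₁(0) = 0`, `ord b ≥ 3`, `ord c ≥ 5`.  With (C1) (`𝔪ⁿ ⊆ {ord ≥ n}` in the power-series ring): no two-flag of
`K⟦T,X,Z⟧` — hence none of the (excellent) local ring `B′_η`, whose completion it is — reaches a ratio `r₁/r₂ > 2` for `g`; so `σ₁(B′_η, g) = 2!·2 = 4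
< 5 = σ₁(S, f)` (the homogeneous flag `(X, Z; 1, 2, 1)` reaches ratio `2`): THE (K) DROP AT K1.
PROOF (char 2 throughout).  Degree 2: `[X²] = 1 = a₀·β₁²`, `[T²] = 0 = a₀β₀²`, `[Z²] = 0 = a₀β₂²` (`βᵢ` = linear coefficients of `g₁`; `g₁b, c, P` have
order `≥ 4`; `[2m](g₁²) = (βₘ)²`), so `a₀ = β₁⁻² ≠ 0` and `β₀ = β₂ = 0`: `g₁ = β₁X + h`, `ord h ≥ 2`.  Degree 4 at `Z⁴`: `g₁² = β₁²X² + h²`, `g₁ b = β₁Xb + hb`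
— every term but `a·h²` is divisible by `X` or of order `≥ 5`, and `[Z⁴](a h²) = a₀·([Z²]h)²`; so `y = (β₁⁻¹·[Z²]h)²` is a square — contradiction.
-/

set_option linter.dupNamespace false -- mandated namespace of this single-conjunct summit

namespace Summit.ResolutionOfSingularities.ResolutionOfSingularities.Theorems

namespace KWildHom

open MvPowerSeries Finsupp
open Summit.ResolutionOfSingularities.ResolutionOfSingularities.Theorems.WeightedConstruction.Negative.K1WildOrbitFace (coeff_add_self_sq)

variable {K : Type} [Field K]

/-- Coefficients below the order vanish (degree form). [folklore] -/
theorem coeff_eq_zero_of_degree_lt {σ : Type} {F : MvPowerSeries σ K} {n : ℕ} (hF : (n : ℕ∞) ≤ F.order) {e : σ →₀ ℕ}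
    (he : degree e < n) : coeff e F = 0 :=
  coeff_of_lt_order (lt_of_lt_of_le (by exact_mod_cast he) hF)

/-- `[E](a·F) = a(0)·[E]F` when `deg E ≤ ord F`. [folklore] -/
theorem coeff_mul_of_degree_le_order {σ : Type} (a F : MvPowerSeries σ K) (E : σ →₀ ℕ) (hF : ((degree E : ℕ) : ℕ∞) ≤ F.order) :
    coeff E (a * F) = constantCoeff a * coeff E F := by
  classical
  rw [coeff_mul, Finset.sum_eq_single (0, E)]
  · rw [coeff_zero_eq_constantCoeff_apply]
  · rintro ⟨e₁, e₂⟩ hmem hne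
    have hsum : e₁ + e₂ = E := Finset.HasAntidiagonal.mem_antidiagonal.mp hmem
    by_cases he₁ : e₁ = 0
    · subst he₁; rw [zero_add] at hsum; subst hsum; exact absurd rfl hne
    · have hlt : degree e₂ < degree E := by
        rw [← hsum, map_add]
        have : 0 < degree e₁ := Nat.pos_of_ne_zero (fun h => he₁ ((degree_eq_zero_iff e₁).mp h))
        omega
      rw [coeff_of_lt_order (lt_of_lt_of_le (by exact_mod_cast hlt) hF), mul_zero]
  · intro h; exact absurd (Finset.HasAntidiagonal.mem_antidiagonal.mpr (zero_add E)) h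

/-- `[E](X i · b) = 0` when `E i = 0`. [folklore] -/
theorem coeff_X_mul_eq_zero_of_apply_eq_zero {σ : Type} (i : σ) (b : MvPowerSeries σ K) (E : σ →₀ ℕ) (hE : E i = 0) :
    coeff E (X i * b) = 0 :=
  (X_dvd_iff.mp (dvd_mul_right (X i) b)) E hE

/-- **(C2) THE K1 COEFFICIENT CONTRADICTION**: in `K⟦T,X,Z⟧`, `char K = 2`, with `y` NOT a square, `X² + y·Z⁴ + y'·T⁴ + P` (`ord P ≥ 5`) is not of
the form `a·g₁² + g₁·b + c` with `g₁(0) = 0`, `ord b ≥ 3`, `ord c ≥ 5` — the shape forced by (C1) on any order-2 germ reaching a two-flag triple of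
ratio `> 2`.  [OURS · L1 W4.3] -/
theorem not_eq_sq_flag_form [CharP K 2] (y y' : K) (hy : ¬ IsSquare y) (P a b c g₁ : MvPowerSeries (Fin 3) K)
    (hP : (5 : ℕ∞) ≤ P.order) (hb : (3 : ℕ∞) ≤ b.order) (hc : (5 : ℕ∞) ≤ c.order) (hg₁ : constantCoeff g₁ = 0)
    (h : (X 1 ^ 2 + C y * X 2 ^ 4 + C y' * X 0 ^ 4 + P : MvPowerSeries (Fin 3) K) = a * g₁ ^ 2 + g₁ * b + c) : False := by
  classical
  haveI : CharP (MvPowerSeries (Fin 3) K) 2 := charP_of_injective_ringHom MvPowerSeries.C_injective 2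
  -- orders
  have hg₁1 : (1 : ℕ∞) ≤ g₁.order := (one_le_order_iff_constCoeff_eq_zero).mpr hg₁
  have hg₁b : (4 : ℕ∞) ≤ (g₁ * b).order := by
    have := le_order_mul (f := g₁) (g := b)
    have h4 : (4 : ℕ∞) ≤ g₁.order + b.order := by
      calc (4 : ℕ∞) = 1 + 3 := by norm_num
        _ ≤ g₁.order + b.order := add_le_add hg₁1 hb
    exact h4.trans this
  have hsq2 : (2 : ℕ∞) ≤ (g₁ ^ 2).order := by
    have := le_order_pow (f := g₁) 2
    have h2 : (2 : ℕ∞) ≤ 2 • g₁.order := by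
      calc (2 : ℕ∞) = 2 • (1 : ℕ∞) := by norm_num
        _ ≤ 2 • g₁.order := nsmul_le_nsmul_right hg₁1 2
    exact h2.trans this
  -- linear coefficients of `g₁`
  set β : Fin 3 → K := fun i => coeff (single i 1) g₁ with hβ
  -- degree-2 coefficients: `[2eᵢ]`
  have deg2 : ∀ i : Fin 3, coeff (single i 2) (X 1 ^ 2 + C y * X 2 ^ 4 + C y' * X 0 ^ 4 + P : MvPowerSeries (Fin 3) K) =
      constantCoeff a * β i ^ 2 := by
    intro i
    have hE : degree (single i 2 : Fin 3 →₀ ℕ) = 2 := degree_single _ _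
    rw [h, map_add, map_add, coeff_mul_of_degree_le_order a (g₁ ^ 2) _ (by rw [hE]; exact hsq2),
      show (single i 2 : Fin 3 →₀ ℕ) = single i 1 + single i 1 by rw [← single_add], coeff_add_self_sq,
      ← show (single i 2 : Fin 3 →₀ ℕ) = single i 1 + single i 1 by rw [← single_add],
      coeff_eq_zero_of_degree_lt (n := 4) hg₁b (by rw [hE]; norm_num), coeff_eq_zero_of_degree_lt (n := 5) hc (by rw [hE]; norm_num),
      add_zero, add_zero]
  -- left-hand sides
  have lhs2 : ∀ i : Fin 3, coeff (single i 2) (X 1 ^ 2 + C y * X 2 ^ 4 + C y' * X 0 ^ 4 + P : MvPowerSeries (Fin 3) K) =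
      if i = 1 then 1 else 0 := by
    intro i
    have hE : degree (single i 2 : Fin 3 →₀ ℕ) = 2 := degree_single _ _
    rw [map_add, map_add, map_add, coeff_eq_zero_of_degree_lt (n := 5) hP (by rw [hE]; norm_num), add_zero,
      X_pow_eq, coeff_monomial, X_pow_eq, X_pow_eq, coeff_C_mul, coeff_C_mul, coeff_monomial, coeff_monomial]
    have h24 : (single i 2 : Fin 3 →₀ ℕ) ≠ single 2 4 := fun h' => by
      have := DFunLike.congr_fun h' i; simp [single_apply] at this; (split_ifs at this; omega)
    have h04 : (single i 2 : Fin 3 →₀ ℕ) ≠ single 0 4 := fun h' => by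
      have := DFunLike.congr_fun h' i; simp [single_apply] at this; (split_ifs at this; omega)
    rw [if_neg h24, if_neg h04, mul_zero, mul_zero, add_zero, add_zero]
    by_cases hi : i = 1
    · subst hi; simp
    · rw [if_neg hi, if_neg]; intro h'; exact hi ((single_left_injective two_ne_zero) h')
  have e1 : constantCoeff a * β 1 ^ 2 = 1 := by rw [← deg2 1, lhs2 1, if_pos rfl]
  have ha0 : constantCoeff a ≠ 0 := fun h0 => by rw [h0, zero_mul] at e1; exact zero_ne_one e1
  have e0 : β 0 = 0 := by
    have := deg2 0; rw [lhs2 0, if_neg (by decide)] at this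
    exact pow_eq_zero_iff (n := 2) two_ne_zero |>.mp ((mul_eq_zero.mp this.symm).resolve_left ha0)
  have e2 : β 2 = 0 := by
    have := deg2 2; rw [lhs2 2, if_neg (by decide)] at this
    exact pow_eq_zero_iff (n := 2) two_ne_zero |>.mp ((mul_eq_zero.mp this.symm).resolve_left ha0)
  -- `g₁ = β₁ X + h`, `ord h ≥ 2`
  set hh := g₁ - C (β 1) * X 1 with hhdef
  have hg₁eq : g₁ = C (β 1) * X 1 + hh := by rw [hhdef]; ring
  have hh2 : (2 : ℕ∞) ≤ hh.order := by
    refine nat_le_order fun d hd => ?_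
    rw [hhdef, map_sub, coeff_C_mul, coeff_X]
    rcases Nat.lt_succ_iff.mp hd |> Nat.le_one_iff_eq_zero_or_eq_one.mp ∘ (fun h => by exact_mod_cast h) with hd0 | hd1
    · rw [(degree_eq_zero_iff d).mp hd0, coeff_zero_eq_constantCoeff_apply, hg₁, if_neg (by
        intro h'; have := DFunLike.congr_fun h' 1; simp at this), mul_zero, sub_zero]
    · -- degree 1: `d = single j 1`
      obtain ⟨j, rfl⟩ : ∃ j, d = single j 1 := by
        have hd1' : degree d = 1 := hd1
        rw [degree_eq_sum] at hd1'
        obtain ⟨j, hj⟩ : ∃ j, d j ≠ 0 := by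
          by_contra hcon; push Not at hcon
          have : d = 0 := Finsupp.ext hcon
          subst this; simp at hd1'
        refine ⟨j, Finsupp.ext fun l => ?_⟩
        have hle : ∀ l, d l ≤ 1 := fun l => by
          have := Finset.single_le_sum (f := fun l => d l) (fun l _ => Nat.zero_le _) (Finset.mem_univ l); omega
        by_cases hl : l = j
        · subst hl; rw [single_eq_same]; have := hle l; omega
        · rw [single_eq_of_ne hl]
          have hsum := hd1'
          have h2 := Finset.add_le_sum (f := fun l => d l) (fun l _ => Nat.zero_le _) (Finset.mem_univ j) (Finset.mem_univ l) (Ne.symm hl)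
          have := Nat.pos_of_ne_zero hj
          omega
      fin_cases j
      · rw [if_neg (by intro h'; have := DFunLike.congr_fun h' 1; simp at this), mul_zero, sub_zero]
        exact e0
      · simp [hβ]
      · rw [if_neg (by intro h'; have := DFunLike.congr_fun h' 1; simp at this), mul_zero, sub_zero]
        exact e2
  -- degree 4 at `Z⁴ = single 2 4 = (single 2 2) + (single 2 2)`
  have hsq4 : (4 : ℕ∞) ≤ (hh ^ 2).order := by
    have := le_order_pow (f := hh) 2
    have h4 : (4 : ℕ∞) ≤ 2 • hh.order := by
      calc (4 : ℕ∞) = 2 • (2 : ℕ∞) := by norm_num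
        _ ≤ 2 • hh.order := nsmul_le_nsmul_right hh2 2
    exact h4.trans this
  have hhb : (5 : ℕ∞) ≤ (hh * b).order := by
    have := le_order_mul (f := hh) (g := b)
    have h5 : (5 : ℕ∞) ≤ hh.order + b.order := by
      calc (5 : ℕ∞) = 2 + 3 := by norm_num
        _ ≤ hh.order + b.order := add_le_add hh2 hb
    exact h5.trans this
  have hE4 : degree (single (2 : Fin 3) 4 : Fin 3 →₀ ℕ) = 4 := degree_single _ _
  have hsq : g₁ ^ 2 = C (β 1) ^ 2 * X 1 ^ 2 + hh ^ 2 := by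
    rw [hg₁eq, add_pow_char, mul_pow]
  have rhs4 : coeff (single (2 : Fin 3) 4) (a * g₁ ^ 2 + g₁ * b + c) = constantCoeff a * (coeff (single (2 : Fin 3) 2) hh) ^ 2 := by
    rw [map_add, map_add, hsq, mul_add, map_add, hg₁eq, add_mul, map_add,
      show a * (C (β 1) ^ 2 * X 1 ^ 2) = X 1 * (a * C (β 1) ^ 2 * X 1) by ring,
      show C (β 1) * X 1 * b = X 1 * (C (β 1) * b) by ring,
      coeff_X_mul_eq_zero_of_apply_eq_zero 1 _ _ (by simp),
      coeff_X_mul_eq_zero_of_apply_eq_zero 1 _ _ (by simp),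
      coeff_mul_of_degree_le_order a (hh ^ 2) _ (by rw [hE4]; exact hsq4),
      show (single (2 : Fin 3) 4 : Fin 3 →₀ ℕ) = single 2 2 + single 2 2 by rw [← single_add], coeff_add_self_sq,
      ← show (single (2 : Fin 3) 4 : Fin 3 →₀ ℕ) = single 2 2 + single 2 2 by rw [← single_add],
      coeff_eq_zero_of_degree_lt (n := 5) hhb (by rw [hE4]; norm_num), coeff_eq_zero_of_degree_lt (n := 5) hc (by rw [hE4]; norm_num)]
    ring
  have lhs4 : coeff (single (2 : Fin 3) 4) (X 1 ^ 2 + C y * X 2 ^ 4 + C y' * X 0 ^ 4 + P : MvPowerSeries (Fin 3) K) = y := by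
    rw [map_add, map_add, map_add, coeff_eq_zero_of_degree_lt (n := 5) hP (by rw [hE4]; norm_num), add_zero,
      X_pow_eq, coeff_monomial, X_pow_eq, X_pow_eq, coeff_C_mul, coeff_C_mul, coeff_monomial, coeff_monomial,
      if_neg (by intro h'; have := DFunLike.congr_fun h' 2; simp at this), if_pos rfl,
      if_neg (by intro h'; have := DFunLike.congr_fun h' 2; simp at this)]
    ring
  have key : y = constantCoeff a * (coeff (single (2 : Fin 3) 2) hh) ^ 2 := by rw [← lhs4, h, rhs4]
  -- `a₀ = (β₁⁻¹)²`, so `y` is a square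
  have hβ1 : β 1 ≠ 0 := fun h0 => by rw [h0, zero_pow two_ne_zero, mul_zero] at e1; exact zero_ne_one e1
  have ha : constantCoeff a = ((β 1)⁻¹) ^ 2 := by
    field_simp; linear_combination e1
  exact hy ⟨(β 1)⁻¹ * coeff (single (2 : Fin 3) 2) hh, by rw [key, ha]; ring⟩

end KWildHom

end Summit.ResolutionOfSingularities.ResolutionOfSingularities.Theorems
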